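/-
Copyright (c) 2026 the pub-hodgecm-mathlib formalisation cell (harness21).  Prover seat hodgecm-mathlib-K2E3-p23 (g5), HCML Track B «K2-LIT» ∕ h413
(`stmt-HodgeConjecture-24833`), line `K2_E3_EllipticInputs`, unit U12 «Characters», road «GL-[M6]-sc» (line lead K2E3-p23 (g5), dealer K2E3-plan (g3)),
MEMO «M6sc-BLUEPRINT v4» §1 (ASM): local integrability of the weight `W = Φ_α · G` (`hW` of ★ `nonEllEstimates_of_radius`).  2026-09-04.
-/
import Summits.HodgeConjecture.HodgeConjecture.Theorems.K2E3GL3ModUniformizerNonEllCoordinates   -- ★ p858493 (this seat): the coordinates `(h, δ, L)`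
import Mathlib.Analysis.SpecificLimits.Normed
import Mathlib.MeasureTheory.Function.LocallyIntegrable
import HarnessLib

/-!
# Road «GL-[M6]-sc», ASM brick: THE WEIGHT IS LOCALLY INTEGRABLE — `W = Φ_α · G` with `Φ_α = 1[Z not compact]·δ^{-(1∕2+ε)}` (★ (α)) locally integrable
# and `G(x̄) = (a + b·h(x̄) + c·L(x̄))² · q^{3h(x̄)} · δ(x̄)^ε` measurable and bounded on every `Ω N` (Harish-Chandra 1970, VII §3)

Cell `pub/hodgecm-mathlib` (D-0151), Track B «K2-LIT», crux H413 = `stmt-HodgeConjecture-24833`, route of record `HCCMUnconditional`.  Lane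
`--supports stmt-HodgeConjecture-24833 --as helper`; THEOREMS ONLY (no `def`, no `instance`, no `notation`, no named-fact hypothesis, no `sorry`); count-neutral.

The `hball` weight of ★ `ae_setIntegral_norm_conj_le_weight` is `const · (a + b h + c L)² · q^{3h} · δ^{-1∕2}`; off `δ = 0` it factors as `Φ_α · G` with
`Φ_α = 1[¬ compact centraliser] · δ^{-(1∕2+ε)}` — locally integrable by ★ (α) `locallyIntegrable_indicator_not_isCompact_centralizer_rpow_neg` (K2E3-p17 (g7)) — and the
measurable factor `G = (a + b h + c L)² q^{3h} δ^{ε}`, which is BOUNDED on each ball `Ω N` of the exhaustion: `h ≤ N`, `δ ≤ max_{Ω N} δ` (continuity), and the depth is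
absorbed by `δ^ε`: `δ < q^{-(L−1)}` ⇒ `L² δ^ε ≤ L² ρ^{L−1} ≤ ρ⁻¹ · sup_n n² ρⁿ` with `ρ = q^{-ε} < 1`.  Hence `Φ_α · G` is integrable on every `Ω N` (bounded × integrable) and
locally integrable (`Ω (N+1)` is a neighbourhood of every point of `Ω N`).
* §1 `exists_sq_mul_pow_le`; §2 `measurable_weightFactor`, `exists_weightFactor_le_on`; §3 `locallyIntegrable_of_integrableOn_exhaustion`,
  **`locallyIntegrable_mul_weightFactor`**.
HONEST LABEL: HC_CM is proved only modulo the 7 printed citations (2 remaining named inputs: hLiu418 = stmt-HodgeConjecture-24832, h413 = stmt-HodgeConjecture-24833) until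
rung 0 closes; count-neutral helper, closes no socket.

## References
* [HarishChandra1970] Harish-Chandra (notes by G. van Dijk), *Harmonic Analysis on Reductive p-adic Groups*, LNM 162 (1970), Part V §6 Theorem 15 p. 63; Part VII §3 pp. 72–73.
-/

set_option autoImplicit false
-- the mandated namespace repeats the single-problem summit's segment (`HodgeConjecture.HodgeConjecture`)
set_option linter.dupNamespace false

noncomputable section

open MeasureTheory Measure Set Filter Topology
open scoped NNReal

namespace Summit.HodgeConjecture.HodgeConjecture.Cruxes.H413.K2E3GL3ModUniformizerNonEllWeight

/-! ## §1 A real inequality -/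

/-- `n² ρⁿ` is bounded for `0 ≤ ρ < 1`. [folklore] -/
theorem exists_sq_mul_pow_le {ρ : ℝ} (hρ0 : 0 ≤ ρ) (hρ1 : ρ < 1) : ∃ C : ℝ, 0 ≤ C ∧ ∀ n : ℕ, (n : ℝ) ^ 2 * ρ ^ n ≤ C := by
  have ht := tendsto_pow_const_mul_const_pow_of_abs_lt_one 2 (show |ρ| < 1 by rwa [abs_of_nonneg hρ0])
  obtain ⟨C, hC⟩ := ht.bddAbove_range
  refine ⟨max C 0, le_max_right _ _, fun n => (hC ⟨n, rfl⟩).trans (le_max_left _ _)⟩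

/-! ## §2 The measurable factor `G = (a + b h + c L)² · q^{3h} · δ^ε` and its bound on `Ω N` -/
section Factor

variable {X : Type*} [TopologicalSpace X] [MeasurableSpace X] [BorelSpace X]

/-- `G` is measurable (`h`, `L` measurable, `δ` continuous). [folklore] -/
theorem measurable_weightFactor {hgt L : X → ℕ} {δ : X → ℝ≥0} (hm : Measurable hgt) (hLm : Measurable L) (hδc : Continuous δ) (q : ℝ) (a b c ε : ℝ) :
    Measurable fun x => (a + b * (hgt x : ℝ) + c * (L x : ℝ)) ^ 2 * q ^ (3 * hgt x) * ((δ x : ℝ)) ^ ε := by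
  have h1 : Measurable fun x => (hgt x : ℝ) := (measurable_from_nat (f := fun n : ℕ => (n : ℝ))).comp hm
  have h2 : Measurable fun x => (L x : ℝ) := (measurable_from_nat (f := fun n : ℕ => (n : ℝ))).comp hLm
  have h3 : Measurable fun x => q ^ (3 * hgt x) := (measurable_from_nat (f := fun n : ℕ => q ^ (3 * n))).comp hm
  have h4 : Measurable fun x => ((δ x : ℝ)) ^ ε := (measurable_coe_nnreal_real.comp hδc.measurable).pow_const ε
  exact ((((measurable_const.add (measurable_const.mul h1)).add (measurable_const.mul h2)).pow_const 2).mul h3).mul h4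

omit [MeasurableSpace X] [BorelSpace X] in
/-- **`G` IS BOUNDED ON `Ω N`**: `h ≤ N` there, `δ ≤ max_{Ω N} δ`, and `L² δ^ε ≤ ρ⁻¹ sup_n n²ρⁿ` (`ρ = q^{-ε}`) from the minimality of the depth (`δ < q^{-(L−1)}` when `L > 0`).
[cite: HarishChandra1970, Part VII §3 p. 72] -/
theorem exists_weightFactor_le_on (Ω : CompactExhaustion X) {hgt L : X → ℕ} {δ : X → ℝ≥0}
    (hhgt : ∀ (n : ℕ) x, x ∈ Ω n → hgt x ≤ n) (hδc : Continuous δ) {q : ℝ} (hq : 1 < q)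
    (hL0 : ∀ x, 0 < L x → δ x < ((q⁻¹ : ℝ).toNNReal) ^ (L x - 1)) {a b c ε : ℝ} (ha : 0 ≤ a) (hb : 0 ≤ b) (hε : 0 < ε) (N : ℕ) :
    ∃ C : ℝ, ∀ x ∈ Ω N, (a + b * (hgt x : ℝ) + c * (L x : ℝ)) ^ 2 * q ^ (3 * hgt x) * ((δ x : ℝ)) ^ ε ≤ C := by
  have hq0 : 0 < q := zero_lt_one.trans hq
  -- `ρ = q^{-ε} ∈ (0,1)`
  set ρ : ℝ := (q⁻¹) ^ ε with hρ
  have hρ0 : 0 < ρ := Real.rpow_pos_of_pos (inv_pos.2 hq0) ε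
  have hρ1 : ρ < 1 := Real.rpow_lt_one (inv_pos.2 hq0).le (inv_lt_one_of_one_lt₀ hq) hε
  obtain ⟨C₁, hC₁0, hC₁⟩ := exists_sq_mul_pow_le hρ0.le hρ1
  -- `δ ≤ A` on `Ω N`
  obtain ⟨A, hA⟩ := (Ω.isCompact N).bddAbove_image hδc.continuousOn
  have hA' : ∀ x ∈ Ω N, δ x ≤ A := fun x hx => hA ⟨x, hx, rfl⟩
  refine ⟨(2 * (a + b * N) ^ 2 * (A : ℝ) ^ ε + 2 * c ^ 2 * (ρ⁻¹ * C₁)) * q ^ (3 * N), fun x hx => ?_⟩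
  have hN := hhgt N x hx
  have hqpow : q ^ (3 * hgt x) ≤ q ^ (3 * N) := pow_le_pow_right₀ hq.le (by omega)
  have hδε0 : 0 ≤ ((δ x : ℝ)) ^ ε := Real.rpow_nonneg (δ x).2 ε
  have hδεA : ((δ x : ℝ)) ^ ε ≤ (A : ℝ) ^ ε := Real.rpow_le_rpow (δ x).2 (NNReal.coe_le_coe.2 (hA' x hx)) hε.le
  -- the depth term
  have hLρ : ((L x : ℝ)) ^ 2 * ((δ x : ℝ)) ^ ε ≤ ρ⁻¹ * C₁ := by
    rcases Nat.eq_zero_or_pos (L x) with h0 | hpos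
    · rw [h0]; simp only [Nat.cast_zero, ne_eq, OfNat.ofNat_ne_zero, not_false_eq_true, zero_pow, zero_mul]
      exact mul_nonneg (inv_nonneg.2 hρ0.le) hC₁0
    · have hlt := hL0 x hpos
      have hδle : ((δ x : ℝ)) ≤ (q⁻¹) ^ (L x - 1) := by
        have := NNReal.coe_le_coe.2 hlt.le
        rwa [NNReal.coe_pow, Real.coe_toNNReal _ (inv_nonneg.2 hq0.le)] at this
      have hδε : ((δ x : ℝ)) ^ ε ≤ ρ ^ (L x - 1) := by
        refine (Real.rpow_le_rpow (δ x).2 hδle hε.le).trans (le_of_eq ?_)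
        rw [hρ, ← Real.rpow_natCast, ← Real.rpow_mul (inv_nonneg.2 hq0.le), mul_comm, Real.rpow_mul (inv_nonneg.2 hq0.le), Real.rpow_natCast]
      have hkey : ((L x : ℝ)) ^ 2 * ρ ^ (L x - 1) = ρ⁻¹ * (((L x : ℝ)) ^ 2 * ρ ^ (L x)) := by
        obtain ⟨n, hn⟩ : ∃ n, L x = n + 1 := ⟨L x - 1, by omega⟩
        rw [hn, Nat.add_sub_cancel]; field_simp; ring
      calc ((L x : ℝ)) ^ 2 * ((δ x : ℝ)) ^ ε ≤ ((L x : ℝ)) ^ 2 * ρ ^ (L x - 1) := by gcongr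
        _ = ρ⁻¹ * (((L x : ℝ)) ^ 2 * ρ ^ (L x)) := hkey
        _ ≤ ρ⁻¹ * C₁ := by gcongr; exact hC₁ _
  -- assemble
  have hsq : (a + b * (hgt x : ℝ) + c * (L x : ℝ)) ^ 2 ≤ 2 * (a + b * N) ^ 2 + 2 * (c * (L x : ℝ)) ^ 2 := by
    have h0 : (a + b * (hgt x : ℝ) + c * (L x : ℝ)) ^ 2 ≤ 2 * (a + b * (hgt x : ℝ)) ^ 2 + 2 * (c * (L x : ℝ)) ^ 2 := by
      nlinarith [sq_nonneg (a + b * (hgt x : ℝ) - c * (L x : ℝ))]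
    refine h0.trans ?_
    have h1 : 0 ≤ a + b * (hgt x : ℝ) := add_nonneg ha (mul_nonneg hb (Nat.cast_nonneg _))
    have h2 : a + b * (hgt x : ℝ) ≤ a + b * N := by gcongr
    nlinarith [h1, h2]
  calc (a + b * (hgt x : ℝ) + c * (L x : ℝ)) ^ 2 * q ^ (3 * hgt x) * ((δ x : ℝ)) ^ ε
      ≤ (2 * (a + b * N) ^ 2 + 2 * (c * (L x : ℝ)) ^ 2) * q ^ (3 * N) * ((δ x : ℝ)) ^ ε := by gcongr
    _ = (2 * (a + b * N) ^ 2 * ((δ x : ℝ)) ^ ε + 2 * c ^ 2 * (((L x : ℝ)) ^ 2 * ((δ x : ℝ)) ^ ε)) * q ^ (3 * N) := by ring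
    _ ≤ (2 * (a + b * N) ^ 2 * (A : ℝ) ^ ε + 2 * c ^ 2 * (ρ⁻¹ * C₁)) * q ^ (3 * N) := by gcongr

end Factor

/-! ## §3 Local integrability of `Φ · G` -/
section LocInt

variable {X : Type*} [TopologicalSpace X] [MeasurableSpace X]

/-- Integrability on every set of a compact exhaustion gives local integrability (`Ω (n+1)` is a neighbourhood of `Ω n`). [folklore] -/
theorem locallyIntegrable_of_integrableOn_exhaustion (Ω : CompactExhaustion X) {f : X → ℝ} {μ : Measure X}
    (h : ∀ n, IntegrableOn f (Ω n) μ) : LocallyIntegrable f μ := by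
  intro x
  obtain ⟨n, hn⟩ := Ω.exists_mem x
  exact ⟨Ω (n + 1), mem_interior_iff_mem_nhds.1 (Ω.subset_interior_succ n hn), h (n + 1)⟩

variable [BorelSpace X] [T2Space X]

/-- **`W = Φ · G` IS LOCALLY INTEGRABLE** for `Φ` locally integrable (★ (α): `Φ = 1[¬ compact centraliser]·δ^{-(1∕2+ε)}`) and the factor `G = (a + b h + c L)² q^{3h} δ^ε` of §2
(measurable, bounded on each `Ω N`). [cite: HarishChandra1970, Part V §6 Theorem 15 p. 63; Part VII §3 pp. 72–73] -/
theorem locallyIntegrable_mul_weightFactor (Ω : CompactExhaustion X) {μ : Measure X} {Φ : X → ℝ} (hΦ : LocallyIntegrable Φ μ)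
    {hgt L : X → ℕ} {δ : X → ℝ≥0} (hm : Measurable hgt) (hhgt : ∀ (n : ℕ) x, x ∈ Ω n → hgt x ≤ n) (hδc : Continuous δ) (hLm : Measurable L)
    {q : ℝ} (hq : 1 < q) (hL0 : ∀ x, 0 < L x → δ x < ((q⁻¹ : ℝ).toNNReal) ^ (L x - 1)) {a b c ε : ℝ} (ha : 0 ≤ a) (hb : 0 ≤ b) (hε : 0 < ε) :
    LocallyIntegrable (fun x => Φ x * ((a + b * (hgt x : ℝ) + c * (L x : ℝ)) ^ 2 * q ^ (3 * hgt x) * ((δ x : ℝ)) ^ ε)) μ := by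
  refine locallyIntegrable_of_integrableOn_exhaustion Ω fun N => ?_
  obtain ⟨C, hC⟩ := exists_weightFactor_le_on Ω hhgt hδc hq hL0 ha hb hε (c := c) N
  have hG := measurable_weightFactor hm hLm hδc q a b c ε
  have hΦN : IntegrableOn Φ (Ω N) μ := hΦ.integrableOn_isCompact (Ω.isCompact N)
  have hbd : ∀ᵐ x ∂μ.restrict (Ω N), ‖(a + b * (hgt x : ℝ) + c * (L x : ℝ)) ^ 2 * q ^ (3 * hgt x) * ((δ x : ℝ)) ^ ε‖ ≤ C := by
    filter_upwards [ae_restrict_mem (Ω.isClosed N).measurableSet] with x hx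
    have hq0 : 0 ≤ q := zero_le_one.trans hq.le
    rw [Real.norm_eq_abs, abs_of_nonneg (by positivity)]
    exact hC x hx
  have := hΦN.mul_bdd hG.aestronglyMeasurable hbd
  simpa only [IntegrableOn] using this

end LocInt

end Summit.HodgeConjecture.HodgeConjecture.Cruxes.H413.K2E3GL3ModUniformizerNonEllWeight

end
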